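import Literature.Topology.FourManifolds.LatticeFormsRankOneDiscriminantFormIsometries
import HarnessLib

/-!
# The count modulo `4n`: `x² ≡ 1 (mod 4n)` has `2^{ω(n)+1}` solutions in `ℤ/4n`, i.e. `|((ℤ/4n)^×)₂| = 2^{ω(n)+1}`
# (Gritsenko–Hulek–Sankaran, Doc. Math. 12 (2007), proof of Lemma 4.3; Oguiso, Math. Res. Lett. 9 (2002), Lemma 4.5)

Sequel of `LatticeFormsRankOneDiscriminantFormIsometries.lean` (row g39-#1), whose §2 counts the residues
`u mod 2n` with `u² ≡ 1 mod 4n` (`natCard_zmod_two_mul_sq_sub_one_dvd : … = 2 ^ n.primeFactors.card`) — the count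
that equals `|O(q_{ℤ(2n)})|`. Both printed sources state the count MODULO `4n` first and halve it; this file supplies
that count. Written for lane `lit-hodgefound` (Track 2 foundations; prover seat `lit-hodgefound-p18`, gen 39,
row g39-#5). THEOREMS ONLY — no definition, no named fact, no instance, no notation.

## Sources, verbatim

* V. Gritsenko, K. Hulek, G. K. Sankaran, *The Hirzebruch–Mumford volume for the orthogonal group and
  applications*, Doc. Math. 12 (2007) 215–241, §4 proof of Lemma 4.3 (held text `paper:arxiv-math_0512595` p. 11):
  "Hence `φ` is orthogonal if and only if `−x²/2d ≡ −1/2d mod 2ℤ`, or equivalently `x² ≡ 1 mod 4dℤ`. It is not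
  difficult to check that this equation has `2^{ρ(d)+1}` solutions modulo `4dℤ`, and hence `2^{ρ(d)}` solutions
  modulo `2dℤ`." (`ρ(d)` = the number of prime divisors of `d`.)
* K. Oguiso, *K3 surfaces via almost-primes*, Math. Res. Lett. 9 (2002) 47–63, §4 proof of Lemma 4.5 (held text
  `paper:arxiv-math_0110282` p. 10): "`|((ℤ/4n)^×)₂| = 2^{ω(n)+1}` […] the natural surjection
  `(ℤ/4n)^× → (ℤ/2n)^×` […] is a two-to-one map".

## Contents (all proved)

* `sq_eq_one_iff_dvd_val_sq_sub_one` (`x² = 1` in `ℤ/N` iff `N ∣ x̃² − 1`), `four_mul_dvd_sq_sub_one_iff_of_eq_add`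
  (`x̃ = r + 2nq ⇒ (4n ∣ x̃² − 1 ⟺ 4n ∣ r² − 1)`: the condition only depends on `x mod 2n`).
* **`natCard_sq_eq_one_zmod_four_mul : Nat.card {x : ZMod (4n) // x² = 1} = 2 ^ (n.primeFactors.card + 1)`**
  (`n ≥ 1`), by the explicit two-to-one bijection `{x ∈ ℤ/4n : x² = 1} ≃ {u mod 2n : 4n ∣ ũ² − 1} × ℤ/2`,
  `x ↦ (x mod 2n, ⌊x̃/2n⌋)`, and g39-#1's count.
* **`natCard_units_sq_eq_one_zmod_four_mul`**: Oguiso's form, the `2`-torsion `((ℤ/4n)^×)₂` of the unit group has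
  order `2^{ω(n)+1}`.

## References

* [GritsenkoHulekSankaran2007HM] Doc. Math. 12 (2007) 215–241 (arXiv:math/0512595): §4 proof of Lemma 4.3.
* [Oguiso2002K3AlmostPrimes] K. Oguiso, K3 surfaces via almost-primes, Math. Res. Lett. 9 (2002) 47–63
  (arXiv:math/0110282): §4 Lemma 4.5.
-/

noncomputable section

namespace Literature.Topology.FourManifolds

/-! ### §1 `x² = 1` in `ℤ/N` as a divisibility -/

/-- `x² = 1` in `ℤ/N` iff `N ∣ x̃² − 1` for the representative `x̃ = x.val ∈ [0, N)`.
[cite: Oguiso2002K3AlmostPrimes, §4 proof of Lemma 4.5] -/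
theorem sq_eq_one_iff_dvd_val_sq_sub_one {N : ℕ} [NeZero N] (x : ZMod N) :
    x ^ 2 = 1 ↔ (N : ℤ) ∣ (x.val : ℤ) ^ 2 - 1 := by
  rw [← ZMod.intCast_zmod_eq_zero_iff_dvd]
  push_cast
  rw [ZMod.natCast_zmod_val, sub_eq_zero]

/-- Reduction `ℤ/4n → ℤ/2n` does not change the condition `x² ≡ 1 mod 4n`: for `x̃ = r + 2n·q`,
`x̃² − 1 ≡ r² − 1 mod 4n`. [cite: Oguiso2002K3AlmostPrimes, §4 proof of Lemma 4.5 ("the natural surjection `(ℤ/4n)^× → (ℤ/2n)^×` … is a two-to-one map")] [cite: GritsenkoHulekSankaran2007HM, §4 proof of Lemma 4.3 ("`2^{ρ(d)+1}` solutions modulo `4dℤ`, and hence `2^{ρ(d)}` solutions modulo `2dℤ`")] -/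
theorem four_mul_dvd_sq_sub_one_iff_of_eq_add (n : ℕ) {x r q : ℤ} (h : x = r + 2 * n * q) :
    (4 * n : ℤ) ∣ x ^ 2 - 1 ↔ (4 * n : ℤ) ∣ r ^ 2 - 1 := by
  have hk : x ^ 2 - 1 = 4 * n * (q * r + n * q ^ 2) + (r ^ 2 - 1) := by rw [h]; ring
  rw [hk]
  exact dvd_add_right (dvd_mul_right _ _)

/-! ### §2 `|{x ∈ ℤ/4n : x² = 1}| = 2^{ω(n)+1}` -/

/-- **`x² ≡ 1 mod 4n` has `2^{ω(n)+1}` solutions modulo `4n`** (`n ≥ 1`; `ω(n)` = the number of prime divisors of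
`n`), by the two-to-one correspondence `x ↦ (x mod 2n, ⌊x̃/2n⌋)` with the residues `u mod 2n`, `u² ≡ 1 mod 4n`
("the natural surjection `(ℤ/4n)^× → (ℤ/2n)^×` … is a two-to-one map") — GHS: "It is not difficult to check that this equation has `2^{ρ(d)+1}` solutions modulo `4dℤ`, and hence
`2^{ρ(d)}` solutions modulo `2dℤ`" (the latter count is `natCard_zmod_two_mul_sq_sub_one_dvd`); Oguiso:
"`|((ℤ/4n)^×)₂| = 2^{ω(n)+1}`" for the `2`-torsion part of the unit group.
[cite: GritsenkoHulekSankaran2007HM, §4 proof of Lemma 4.3] [cite: Oguiso2002K3AlmostPrimes, §4 Lemma 4.5 (proof)] -/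
theorem natCard_sq_eq_one_zmod_four_mul {n : ℕ} (hn : 0 < n) :
    Nat.card {x : ZMod (4 * n) // x ^ 2 = 1} = 2 ^ (n.primeFactors.card + 1) := by
  haveI : NeZero (4 * n) := ⟨by omega⟩
  haveI : NeZero (2 * n) := ⟨by omega⟩
  -- the two-to-one correspondence `x ↦ (x mod 2n, ⌊x̃/2n⌋)`, inverse `(u, b) ↦ ũ + 2n·b̃`
  have hval : ∀ (u : ZMod (2 * n)) (b : ZMod 2), u.val + 2 * n * b.val < 4 * n := fun u b ↦ by
    have h1 := u.val_lt
    have h2 := b.val_lt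
    nlinarith
  have e : {x : ZMod (4 * n) // x ^ 2 = 1} ≃ {u : ZMod (2 * n) // (4 * n : ℤ) ∣ (u.val : ℤ) ^ 2 - 1} × ZMod 2 :=
    { toFun := fun x ↦ (⟨((x.1.val : ℕ) : ZMod (2 * n)), by
          have h := (sq_eq_one_iff_dvd_val_sq_sub_one x.1).1 x.2
          rw [ZMod.val_natCast]
          have hx : ((x.1.val : ℕ) : ℤ) = ((x.1.val % (2 * n) : ℕ) : ℤ) + 2 * n * ((x.1.val / (2 * n) : ℕ) : ℤ) := by
            push_cast
            exact_mod_cast (Nat.mod_add_div (x.1.val) (2 * n)).symm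
          exact (four_mul_dvd_sq_sub_one_iff_of_eq_add n hx).1 h⟩,
        ((x.1.val / (2 * n) : ℕ) : ZMod 2))
      invFun := fun p ↦ ⟨((p.1.1.val + 2 * n * p.2.val : ℕ) : ZMod (4 * n)), by
          rw [sq_eq_one_iff_dvd_val_sq_sub_one, ZMod.val_natCast, Nat.mod_eq_of_lt (hval p.1.1 p.2)]
          have hx : ((p.1.1.val + 2 * n * p.2.val : ℕ) : ℤ) = (p.1.1.val : ℤ) + 2 * n * (p.2.val : ℤ) := by
            push_cast; ring
          exact (four_mul_dvd_sq_sub_one_iff_of_eq_add n hx).2 p.1.2⟩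
      left_inv := fun x ↦ by
        apply Subtype.ext
        have hq : x.1.val / (2 * n) < 2 := by
          rw [Nat.div_lt_iff_lt_mul (by omega)]
          have := x.1.val_lt
          omega
        simp only [ZMod.val_natCast, Nat.mod_eq_of_lt hq, Nat.mod_add_div, ZMod.natCast_zmod_val]
      right_inv := fun p ↦ by
        obtain ⟨⟨u, hu⟩, b⟩ := p
        have hv : (((u.val + 2 * n * b.val : ℕ) : ZMod (4 * n))).val = u.val + 2 * n * b.val := by
          rw [ZMod.val_natCast, Nat.mod_eq_of_lt (hval u b)]
        refine Prod.ext (Subtype.ext ?_) ?_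
        · simp only [hv]
          rw [Nat.cast_add, Nat.cast_mul, ZMod.natCast_zmod_val, ZMod.natCast_self, zero_mul, add_zero]
        · simp only [hv]
          rw [Nat.add_mul_div_left _ _ (by omega), Nat.div_eq_of_lt u.val_lt, zero_add, ZMod.natCast_zmod_val] }
  rw [Nat.card_congr e, Nat.card_prod, natCard_zmod_two_mul_sq_sub_one_dvd hn, Nat.card_zmod, pow_succ]

/-- **Oguiso's form: the `2`-torsion subgroup `((ℤ/4n)^×)₂ = {x ∈ (ℤ/4n)^× : x² = 1}` of the unit group has order
`2^{ω(n)+1}`** (every `x` with `x² = 1` is a unit). [cite: Oguiso2002K3AlmostPrimes, §4 Lemma 4.5 (proof)] -/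
theorem natCard_units_sq_eq_one_zmod_four_mul {n : ℕ} (hn : 0 < n) :
    Nat.card {x : (ZMod (4 * n))ˣ // x ^ 2 = 1} = 2 ^ (n.primeFactors.card + 1) := by
  rw [← natCard_sq_eq_one_zmod_four_mul hn]
  refine Nat.card_congr
    { toFun := fun x ↦ ⟨(x.1 : ZMod (4 * n)), by rw [← Units.val_pow_eq_pow_val, x.2, Units.val_one]⟩
      invFun := fun x ↦ ⟨⟨x.1, x.1, by rw [← sq, x.2], by rw [← sq, x.2]⟩, Units.ext (by rw [Units.val_pow_eq_pow_val, Units.val_one]; exact x.2)⟩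
      left_inv := fun x ↦ Subtype.ext (Units.ext rfl)
      right_inv := fun x ↦ Subtype.ext rfl }

end Literature.Topology.FourManifolds

end
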